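import Summits.AtomisticToContinuum.BoseEinsteinCondensation.Theses.BECHardSphereReduction
import HarnessLib

/-!
# Crux `HardSphereBEC` (stmt-AtomisticToContinuum-11885), line `registered` — reductions of the
# stub `stub_sparseZeroMode`

Route `BECHardSphereReduction`, skeleton `Cruxes/HardSphereBEC/Lines/birth.lean` (sha c763a27be332).
The registered stub `stub_sparseZeroMode` asks, for every threshold `η₀ > 0`, for SOME reduced
density `η ∈ (0, η₀]` and `c > 0` such that eventually in `N` some slack `δ > 0` makes every
`δ`-near-minimiser of the unit-hard-sphere Dirichlet energy in the box of side `L_N(η) = (N/η)^{1/3}`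
occupy the normalised constant mode `φ₀ = L^{-3/2}·1_{Λ_L}` at least `cN` times.  This file records,
kernel-checked, where the stub sits relative to the route's existing items (pure logic over the route
file; no analysis):

* `sparseZeroMode_of_hardSphereZeroMode` — the support item `HardSphereZeroMode` (stmt-11888: the
  same conclusion for ALL `η` below some `η₁`) implies the stub (take `η := min η₀ (η₁/2)`);
* `sparseZeroMode_of_frequently` / `frequently_of_sparseZeroMode` — the stub is EQUIVALENT to having
  the zero-mode bound along a set of densities accumulating at `0⁺` (`∃ᶠ η in 𝓝[>] 0, …`), the form
  in which an estimate along one chosen sequence `η_k ↓ 0` would deliver it.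
-/

noncomputable section

namespace Summit.AtomisticToContinuum.BoseEinsteinCondensation.Cruxes.HardSphereBEC

open MeasureTheory ENNReal Filter Topology Literature.MathematicalPhysics.QuantumManyBody.BoseGas
open Summit.AtomisticToContinuum.BoseEinsteinCondensation.Theses.BECHardSphereReduction

/-- **`HardSphereZeroMode` (stmt-11888) implies the stub `stub_sparseZeroMode`**: zero-mode
condensation on a whole initial interval `(0, η₁)` of reduced densities gives it at the density
`η := min η₀ (η₁/2) ∈ (0, η₀]` below any threshold `η₀`. [folklore] -/
theorem sparseZeroMode_of_hardSphereZeroMode (hZ : HardSphereZeroMode) :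
    ∀ η₀ : ℝ, 0 < η₀ → ∃ η : ℝ, 0 < η ∧ η ≤ η₀ ∧ ∃ c : ℝ, 0 < c ∧ ∀ᶠ N : ℕ in Filter.atTop,
      ∃ δ : ENNReal, 0 < δ ∧ ∀ Ψ : TrialState N (sideLength η N),
        energy (Set.indicator (Set.Iic 1) (fun _ : ℝ => (⊤ : ENNReal))) Ψ ≤
          groundStateEnergy (Set.indicator (Set.Iic 1) (fun _ : ℝ => (⊤ : ENNReal))) N
            (sideLength η N) + δ →
        ENNReal.ofReal (c * N) ≤ occupation N ((box (sideLength η N)).indicator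
          fun _ => ((Real.sqrt (sideLength η N ^ 3))⁻¹ : ℂ)) Ψ.ψ := by
  obtain ⟨η₁, hη₁, h⟩ := hZ
  intro η₀ hη₀
  refine ⟨min η₀ (η₁ / 2), lt_min hη₀ (half_pos hη₁), min_le_left _ _, ?_⟩
  exact h (min η₀ (η₁ / 2)) (lt_min hη₀ (half_pos hη₁))
    ((min_le_right _ _).trans_lt (half_lt_self hη₁))

/-- **Sparse densities suffice**: if the zero-mode bound holds (with some constant) at densities
accumulating at `0` from the right, then every threshold `η₀ > 0` has such a density below it, i.e.
the stub `stub_sparseZeroMode` holds. [folklore] -/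
theorem sparseZeroMode_of_frequently
    (h : ∃ᶠ η in 𝓝[>] (0 : ℝ), ∃ c : ℝ, 0 < c ∧ ∀ᶠ N : ℕ in Filter.atTop,
      ∃ δ : ENNReal, 0 < δ ∧ ∀ Ψ : TrialState N (sideLength η N),
        energy (Set.indicator (Set.Iic 1) (fun _ : ℝ => (⊤ : ENNReal))) Ψ ≤
          groundStateEnergy (Set.indicator (Set.Iic 1) (fun _ : ℝ => (⊤ : ENNReal))) N
            (sideLength η N) + δ →
        ENNReal.ofReal (c * N) ≤ occupation N ((box (sideLength η N)).indicator
          fun _ => ((Real.sqrt (sideLength η N ^ 3))⁻¹ : ℂ)) Ψ.ψ) :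
    ∀ η₀ : ℝ, 0 < η₀ → ∃ η : ℝ, 0 < η ∧ η ≤ η₀ ∧ ∃ c : ℝ, 0 < c ∧ ∀ᶠ N : ℕ in Filter.atTop,
      ∃ δ : ENNReal, 0 < δ ∧ ∀ Ψ : TrialState N (sideLength η N),
        energy (Set.indicator (Set.Iic 1) (fun _ : ℝ => (⊤ : ENNReal))) Ψ ≤
          groundStateEnergy (Set.indicator (Set.Iic 1) (fun _ : ℝ => (⊤ : ENNReal))) N
            (sideLength η N) + δ →
        ENNReal.ofReal (c * N) ≤ occupation N ((box (sideLength η N)).indicator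
          fun _ => ((Real.sqrt (sideLength η N ^ 3))⁻¹ : ℂ)) Ψ.ψ := by
  intro η₀ hη₀
  have hmem : ∀ᶠ η in 𝓝[>] (0 : ℝ), η ∈ Set.Ioc (0 : ℝ) η₀ := Ioc_mem_nhdsGT hη₀
  obtain ⟨η, hZ, hη, hηle⟩ := (h.and_eventually hmem).exists
  exact ⟨η, hη, hηle, hZ⟩

/-- Conversely the stub gives the frequently-form: below every threshold there is a good density, so
good densities accumulate at `0⁺`.  Hence `stub_sparseZeroMode` is EQUIVALENT to zero-mode
condensation along some sequence `η_k ↓ 0`. [folklore] -/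
theorem frequently_of_sparseZeroMode
    (h : ∀ η₀ : ℝ, 0 < η₀ → ∃ η : ℝ, 0 < η ∧ η ≤ η₀ ∧ ∃ c : ℝ, 0 < c ∧ ∀ᶠ N : ℕ in Filter.atTop,
      ∃ δ : ENNReal, 0 < δ ∧ ∀ Ψ : TrialState N (sideLength η N),
        energy (Set.indicator (Set.Iic 1) (fun _ : ℝ => (⊤ : ENNReal))) Ψ ≤
          groundStateEnergy (Set.indicator (Set.Iic 1) (fun _ : ℝ => (⊤ : ENNReal))) N
            (sideLength η N) + δ →
        ENNReal.ofReal (c * N) ≤ occupation N ((box (sideLength η N)).indicator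
          fun _ => ((Real.sqrt (sideLength η N ^ 3))⁻¹ : ℂ)) Ψ.ψ) :
    ∃ᶠ η in 𝓝[>] (0 : ℝ), ∃ c : ℝ, 0 < c ∧ ∀ᶠ N : ℕ in Filter.atTop,
      ∃ δ : ENNReal, 0 < δ ∧ ∀ Ψ : TrialState N (sideLength η N),
        energy (Set.indicator (Set.Iic 1) (fun _ : ℝ => (⊤ : ENNReal))) Ψ ≤
          groundStateEnergy (Set.indicator (Set.Iic 1) (fun _ : ℝ => (⊤ : ENNReal))) N
            (sideLength η N) + δ →
        ENNReal.ofReal (c * N) ≤ occupation N ((box (sideLength η N)).indicator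
          fun _ => ((Real.sqrt (sideLength η N ^ 3))⁻¹ : ℂ)) Ψ.ψ := by
  rw [Filter.frequently_iff]
  intro U hU
  obtain ⟨ε, hε, hεU⟩ := mem_nhdsGT_iff_exists_Ioc_subset.1 hU
  obtain ⟨η, hη, hηle, hZ⟩ := h ε hε
  exact ⟨η, hεU ⟨hη, hηle⟩, hZ⟩

end Summit.AtomisticToContinuum.BoseEinsteinCondensation.Cruxes.HardSphereBEC

end
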